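import Mathlib
import Literature.NumberTheory.LFunctions.Zhang2022.TypedSection18
import Literature.NumberTheory.LFunctions.Zhang2022.Section18SjNormMajorant
import HarnessLib

/-!
# Zhang (2022) §18, proof of (2.33): tools for the range evaluations of `S_j(𝐚₂₃,𝐚₂₃)`

Topic `Literature/NumberTheory/LFunctions/Zhang2022` (Landau–Siegel audit tree; verdict-neutral).
Y. Zhang, *Discrete mean estimates and the Landau–Siegel zero*, arXiv:2211.02515v1 (2022)
[Zhang2022LandauSiegel], §18 p. 100 (tex L4921–L4946) — an unrefereed manuscript under adjudication
(campaign D-0069, discharge layer L4; cone leaf C27 `Skeleton.Ded183`; GAP-LEDGER row G-d56-1: the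
four range evaluations of `S_j(𝐚₂₃,𝐚₂₃)`, "By the discussion in Section 8 and 10", typed as
`TypedSection18.Step18_range1/Step18_u010/Step18_u011/Step18_u012`, are to be DERIVED from Lemmas
10.1–10.2 (`Skeleton.Lemma101/102`, which evaluate `𝔳₁ⱼ`, `𝔳₂ⱼ`) and (8.10)). This file supplies the
two structural inputs of that derivation, PROVED from the definitions:

* `sj23Term_eq_frakv` (component K1) — the printed `(r,d)`-summand of `S_j(𝐚₂₃,𝐚₂₃)` IS
  `|χ(d)||μχ(r)|λ₀ⱼ(dr)/(drφ(r)) · 𝔳₁ⱼ(dr) · 𝔳₂ⱼ(d,r)` exactly (`𝔳₁ⱼ`, `𝔳₂ⱼ` of Lemmas 10.1–10.2 =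
  `Skeleton.frakv1/frakv2`; the inner sums of `TypedSection18.sj23Term` run over `[1, ⌈PT⁻²⌉)`, those
  of `𝔳₁ⱼ, 𝔳₂ⱼ` over `[1, ⌈P⌉)`, and the extra terms vanish because `f̃(log(drm)/log P) = 0` for
  `m ≥ ⌈PT⁻²⌉ > P^{0.504}`), for `log D ≥ 2`;
* `sum_Ioc_prod_one_add_div_le` (component K2) — the WINDOWED majorant
  `Σ_{Y<n≤Z} n⁻¹∏_{q∣n}(1 + c/q) ≤ eᶜ(1 + log(Z/Y))` (`1 ≤ Y ≤ Z`), companion of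
  `Sec18SjNorm.sum_prod_one_add_div_le`, for the `T`-windows of Lemmas 10.1–10.2.

No claim of the manuscript is asserted; no named fact; nothing bears on Theorems 1–2.

## References

* Y. Zhang, arXiv:2211.02515v1 (2022), §18 p. 100; §10 Lemmas 10.1–10.2 (`𝔳₁ⱼ`, `𝔳₂ⱼ`); §7 (7.2);
  §2 (2.28). [cite: Zhang2022LandauSiegel, §18 p.100]
-/

noncomputable section

open Complex Real Finset

namespace Literature.NumberTheory.LFunctions.Zhang2022.Sec18SjNorm

open Skeleton Typed.Section18

/-! ## K1: the printed summand is `w(d,r)·𝔳₁ⱼ(dr)·𝔳₂ⱼ(d,r)` -/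

section Identification

variable (c' : ℝ) {D : ℕ} (χ : DirichletCharacter ℂ D)

/-- `⌈PT⁻²⌉ ≤ ⌈P⌉` (`T ≥ 1`). [cite: Zhang2022LandauSiegel, §7 (7.2)] -/
theorem Nsupp_le_ceil_bigP (D : ℕ) : Nsupp D ≤ ⌈bigP D⌉₊ := by
  rw [Nsupp]
  apply Nat.ceil_le_ceil
  have hT1 : 1 ≤ bigT D := by
    rw [bigT]; exact Real.one_le_exp (Real.rpow_nonneg (Real.log_natCast_nonneg D) _)
  have hP : 0 ≤ bigP D := (Real.exp_pos _).le
  rw [div_le_iff₀ (by positivity)]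
  calc bigP D = bigP D * 1 := (mul_one _).symm
    _ ≤ bigP D * bigT D ^ 2 := by gcongr; exact one_le_pow₀ hT1

/-- For `m ≥ ⌈PT⁻²⌉` (`log D ≥ 2`) and `d r ≥ 1`: `f̃(log(drm)/log P) = 0` (`drm ≥ m > P₁ = P^{0.504}`).
[cite: Zhang2022LandauSiegel, §2 (2.28)–(2.29); §7 (7.2)] -/
theorem ftilde_log_mul_eq_zero (hD : 2 ≤ Real.log D) {d r m : ℕ} (hd : 1 ≤ d) (hr : 1 ≤ r)
    (hm : Nsupp D ≤ m) : ftilde (Real.log ((d * r * m : ℕ) : ℝ) / Real.log (bigP D)) = 0 := by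
  have hP1m : Skeleton.P1 D < m := P1_lt_of_Nsupp_le D hD hm
  have hle : (m : ℝ) ≤ ((d * r * m : ℕ) : ℝ) := by
    exact_mod_cast Nat.le_mul_of_pos_left m (Nat.mul_pos hd hr)
  have h := ftilde_log_eq_zero_of_P1_lt D hD (lt_of_lt_of_le hP1m hle) (le_refl (0 : ℝ))
  rwa [add_zero] at h

/-- **K1.** The printed `(r,d)`-summand of `S_j(𝐚₂₃,𝐚₂₃)` (Z22 p.100, tex L4922–L4926;
`TypedSection18.sj23Term`) equals `|χ(d)||μχ(r)|λ₀ⱼ(dr)/(drφ(r)) · 𝔳₁ⱼ(dr) · 𝔳₂ⱼ(d,r)` with the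
`𝔳₁ⱼ, 𝔳₂ⱼ` of Lemmas 10.1–10.2 (`Skeleton.frakv1 c′ χ j (dr)`, `Skeleton.frakv2 c′ χ j d r`), for
`log D ≥ 2` and `d, r ≥ 1` — this is what "By the discussion in Section 8 and 10" applies Lemmas 10.1
and 10.2 to. Exact; kernel-checked. [cite: Zhang2022LandauSiegel, §18 p.100; §10 Lemmas 10.1–10.2] -/
theorem sj23Term_eq_frakv (hD : 2 ≤ Real.log D) (j : ℕ) {r d : ℕ} (hr : 1 ≤ r) (hd : 1 ≤ d) :
    sj23Term c' χ j r d =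
      ((‖χ (d : ZMod D)‖ : ℝ) : ℂ) *
          ((‖((ArithmeticFunction.moebius r : ℤ) : ℂ) * χ (r : ZMod D)‖ : ℝ) : ℂ) *
          lamZero c' D j (d * r) / (((d * r : ℕ) : ℂ) * (Nat.totient r : ℂ)) *
        frakv1 c' χ j ((d * r : ℕ) : ℝ) * frakv2 c' χ j d r := by
  have hsub : Ico 1 (Nsupp D) ⊆ Ico 1 ⌈bigP D⌉₊ :=
    Ico_subset_Ico_right (Nsupp_le_ceil_bigP D)
  have hcast : ∀ m : ℕ, ((d * r : ℕ) : ℝ) * (m : ℝ) = ((d * r * m : ℕ) : ℝ) := fun m => by push_cast; ring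
  -- the `m`-sum
  have hM : frakv1 c' χ j ((d * r : ℕ) : ℝ) =
      ∑ m ∈ Ico 1 (Nsupp D), χ (m : ZMod D) *
        (ftilde (Real.log ((d * r * m : ℕ) : ℝ) / Real.log (bigP D)) : ℂ) /
          (m : ℂ) ^ (1 - betaJ c' D j) := by
    rw [frakv1]
    simp_rw [hcast]
    symm
    refine sum_subset hsub fun m hm hm' => ?_
    have hmN : Nsupp D ≤ m := by
      rw [mem_Ico] at hm hm'
      by_contra h
      exact hm' ⟨hm.1, not_le.mp h⟩
    rw [ftilde_log_mul_eq_zero hD hd hr hmN, Complex.ofReal_zero, mul_zero, zero_div]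
  -- the `n`-sum
  have hN : frakv2 c' χ j d r =
      ∑ n ∈ Ico 1 (Nsupp D), χ (n : ZMod D) *
        (ftilde (Real.log ((d * r * n : ℕ) : ℝ) / Real.log (bigP D)) : ℂ) *
          xiZero c' D j n d r / (n : ℂ) := by
    rw [frakv2]
    symm
    refine sum_subset hsub fun n hn hn' => ?_
    have hnN : Nsupp D ≤ n := by
      rw [mem_Ico] at hn hn'
      by_contra h
      exact hn' ⟨hn.1, not_le.mp h⟩
    rw [ftilde_log_mul_eq_zero hD hd hr hnN, Complex.ofReal_zero, mul_zero, zero_mul, zero_div]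
  rw [sj23Term, hM, hN]

end Identification

/-! ## K2: the windowed majorant -/

section Window

/-- The harmonic bound along the multiples of `d ≥ 1` in a window: for `1 ≤ Y ≤ Z`,
`Σ_{Y<n≤Z, d∣n} 1/n ≤ (1 + log(Z/Y))/d`. [folklore] -/
private theorem sum_inv_filter_dvd_Ioc_le {d : ℕ} (hd : 0 < d) {Y Z : ℕ} (hY : 1 ≤ Y) (hYZ : Y ≤ Z) :
    ∑ n ∈ (Ioc Y Z).filter (fun n => d ∣ n), (n : ℝ)⁻¹ ≤ (1 + Real.log ((Z : ℝ) / Y)) / d := by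
  -- the multiples of `d` in `(Y, Z]` are `d·m` with `m ∈ (Y/d, Z/d]`, i.e. `m ∈ Ioc (Y/d) (Z/d)`
  have hsub : (Ioc Y Z).filter (fun n => d ∣ n) ⊆ (Ioc (Y / d) (Z / d)).image (fun m => d * m) := by
    intro n hn
    rw [mem_filter, mem_Ioc] at hn
    obtain ⟨⟨hYn, hnZ⟩, ⟨m, rfl⟩⟩ := hn
    rw [mem_image]
    refine ⟨m, mem_Ioc.mpr ⟨?_, ?_⟩, rfl⟩
    · exact Nat.div_lt_of_lt_mul hYn
    · exact (Nat.le_div_iff_mul_le hd).mpr (by rwa [mul_comm] at hnZ)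
  have hinj : Set.InjOn (fun m => d * m) ((Ioc (Y / d) (Z / d) : Finset ℕ) : Set ℕ) := by
    intro a _ b _ hab
    exact Nat.eq_of_mul_eq_mul_left hd hab
  -- harmonic numbers: `Σ_{a<m≤b} 1/m = H_b − H_a ≤ (1 + log b) − log(a+1) ≤ 1 + log(Z/Y)`
  have hH : ∀ n : ℕ, ∑ m ∈ Ioc 0 n, ((m : ℕ) : ℝ)⁻¹ = (harmonic n : ℝ) := by
    intro n
    rw [harmonic_eq_sum_Icc, ← Finset.Icc_add_one_left_eq_Ioc, zero_add]
    push_cast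
    rfl
  have hharm : ∑ m ∈ Ioc (Y / d) (Z / d), ((m : ℕ) : ℝ)⁻¹ ≤ 1 + Real.log ((Z : ℝ) / Y) := by
    set a := Y / d with ha
    set b := Z / d with hb
    have hab : a ≤ b := Nat.div_le_div_right hYZ
    have hsplit : ∑ m ∈ Ioc a b, ((m : ℕ) : ℝ)⁻¹ = (harmonic b : ℝ) - (harmonic a : ℝ) := by
      rw [← hH a, ← hH b, ← sum_Ioc_consecutive _ (Nat.zero_le a) hab]
      ring
    have h1 : (harmonic b : ℝ) ≤ 1 + Real.log b := harmonic_le_one_add_log b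
    have h2 : Real.log ((a + 1 : ℕ) : ℝ) ≤ (harmonic a : ℝ) := by
      have := log_add_one_le_harmonic a
      push_cast at this ⊢
      exact this
    -- `log b − log(a+1) ≤ log(Z/Y)`
    have hYR : (0 : ℝ) < Y := by exact_mod_cast hY
    have hdR : (0 : ℝ) < d := by exact_mod_cast hd
    have hZY : (1 : ℝ) ≤ (Z : ℝ) / Y := by
      rw [le_div_iff₀ hYR]; exact_mod_cast (by simpa using hYZ)
    have hlog : Real.log b - Real.log ((a + 1 : ℕ) : ℝ) ≤ Real.log ((Z : ℝ) / Y) := by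
      have ha10 : (0 : ℝ) < ((a + 1 : ℕ) : ℝ) := by positivity
      rcases Nat.eq_zero_or_pos b with hb0 | hbpos
      · rw [hb0, Nat.cast_zero, Real.log_zero, zero_sub]
        have : 0 ≤ Real.log ((a + 1 : ℕ) : ℝ) := Real.log_natCast_nonneg _
        linarith [Real.log_nonneg hZY]
      · have hb0 : (0 : ℝ) < b := by exact_mod_cast hbpos
        have ha1 : (Y : ℝ) / d < ((a + 1 : ℕ) : ℝ) := by
          rw [div_lt_iff₀ hdR]
          have h' : Y < (a + 1) * d := (Nat.div_lt_iff_lt_mul hd).mp (Nat.lt_succ_self _)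
          exact_mod_cast h'
        have hbZ : (b : ℝ) ≤ (Z : ℝ) / d := by
          rw [hb]; exact Nat.cast_div_le
        rw [← Real.log_div hb0.ne' ha10.ne']
        apply Real.log_le_log (div_pos hb0 ha10)
        calc (b : ℝ) / ((a + 1 : ℕ) : ℝ) ≤ ((Z : ℝ) / d) / ((Y : ℝ) / d) :=
              div_le_div₀ (by positivity) hbZ (by positivity) ha1.le
          _ = (Z : ℝ) / Y := by field_simp
    rw [hsplit]
    linarith
  calc ∑ n ∈ (Ioc Y Z).filter (fun n => d ∣ n), (n : ℝ)⁻¹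
      ≤ ∑ n ∈ (Ioc (Y / d) (Z / d)).image (fun m => d * m), (n : ℝ)⁻¹ :=
        sum_le_sum_of_subset_of_nonneg hsub fun n _ _ => by positivity
    _ = ∑ m ∈ Ioc (Y / d) (Z / d), ((d * m : ℕ) : ℝ)⁻¹ := sum_image hinj
    _ = (d : ℝ)⁻¹ * ∑ m ∈ Ioc (Y / d) (Z / d), ((m : ℕ) : ℝ)⁻¹ := by
        rw [mul_sum]
        refine sum_congr rfl fun m _ => ?_
        push_cast
        rw [mul_inv]
    _ ≤ (d : ℝ)⁻¹ * (1 + Real.log ((Z : ℝ) / Y)) := by gcongr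
    _ = (1 + Real.log ((Z : ℝ) / Y)) / d := by ring

/-- `Σ_{q ≤ X prime} 1/q² ≤ 1`. [folklore] -/
private theorem sum_primes_inv_sq_le_one' (X : ℕ) :
    ∑ q ∈ (range (X + 1)).filter Nat.Prime, ((q : ℝ) ^ 2)⁻¹ ≤ 1 := by
  have hsub : (range (X + 1)).filter Nat.Prime ⊆ Ioo 1 (X + 1) := by
    intro q hq
    rw [mem_filter, mem_range] at hq
    exact mem_Ioo.mpr ⟨hq.2.one_lt, hq.1⟩
  calc ∑ q ∈ (range (X + 1)).filter Nat.Prime, ((q : ℝ) ^ 2)⁻¹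
      ≤ ∑ q ∈ Ioo 1 (X + 1), ((q : ℝ) ^ 2)⁻¹ :=
        sum_le_sum_of_subset_of_nonneg hsub fun q _ _ => by positivity
    _ ≤ 2 / (1 + 1) := by exact_mod_cast sum_Ioo_inv_sq_le (α := ℝ) 1 (X + 1)
    _ = 1 := by norm_num

/-- **K2. The windowed majorant**: for `c ≥ 0` and `1 ≤ Y ≤ Z`,
`Σ_{Y<n≤Z} n⁻¹ ∏_{q∣n}(1 + c/q) ≤ eᶜ(1 + log(Z/Y))` — the companion of
`sum_prod_one_add_div_le` for the `T`-windows `(P^a/T, P^a]` of Lemmas 10.1–10.2 used in §18.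
[cite: Zhang2022LandauSiegel, §18 p.100; §10 (10.5), (10.11)] -/
theorem sum_Ioc_prod_one_add_div_le {c : ℝ} (hc : 0 ≤ c) {Y Z : ℕ} (hY : 1 ≤ Y) (hYZ : Y ≤ Z) :
    ∑ n ∈ Ioc Y Z, (∏ q ∈ n.primeFactors, (1 + c / (q : ℝ))) / (n : ℝ) ≤
      Real.exp c * (1 + Real.log ((Z : ℝ) / Y)) := by
  classical
  set P : Finset ℕ := (range (Z + 1)).filter Nat.Prime with hP
  have hlogZY : 0 ≤ 1 + Real.log ((Z : ℝ) / Y) := by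
    have hZY : (1 : ℝ) ≤ (Z : ℝ) / Y := by
      rw [le_div_iff₀ (by exact_mod_cast hY)]; exact_mod_cast (by simpa using hYZ)
    have := Real.log_nonneg hZY
    linarith
  have hexp : ∀ n : ℕ, (∏ q ∈ n.primeFactors, (1 + c / (q : ℝ))) / (n : ℝ) =
      ∑ T ∈ n.primeFactors.powerset, (∏ q ∈ T, (c / (q : ℝ))) / (n : ℝ) := by
    intro n
    rw [prod_one_add, sum_div]
  rw [sum_congr rfl fun n _ => hexp n]
  have hswap : ∑ n ∈ Ioc Y Z, ∑ T ∈ n.primeFactors.powerset, (∏ q ∈ T, (c / (q : ℝ))) / (n : ℝ) =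
      ∑ T ∈ P.powerset, ∑ n ∈ (Ioc Y Z).filter (fun n => T ⊆ n.primeFactors),
        (∏ q ∈ T, (c / (q : ℝ))) / (n : ℝ) := by
    refine sum_comm' fun n T => ?_
    simp only [mem_powerset, mem_filter, mem_Ioc]
    constructor
    · rintro ⟨⟨h1, hX⟩, hT⟩
      refine ⟨⟨⟨h1, hX⟩, hT⟩, hT.trans fun q hq => ?_⟩
      rw [hP, mem_filter, mem_range]
      have hq' := Nat.mem_primeFactors.mp hq
      exact ⟨Nat.lt_succ_of_le (le_trans (Nat.le_of_dvd (by omega) hq'.2.1) hX), hq'.1⟩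
    · rintro ⟨⟨⟨h1, hX⟩, hT⟩, _⟩
      exact ⟨⟨h1, hX⟩, hT⟩
  rw [hswap]
  have hinner : ∀ T ∈ P.powerset,
      ∑ n ∈ (Ioc Y Z).filter (fun n => T ⊆ n.primeFactors), (∏ q ∈ T, (c / (q : ℝ))) / (n : ℝ) ≤
        (∏ q ∈ T, (c / (q : ℝ) ^ 2)) * (1 + Real.log ((Z : ℝ) / Y)) := by
    intro T hT
    rw [mem_powerset] at hT
    have hTprime : ∀ q ∈ T, q.Prime := fun q hq => by
      have := hT hq
      rw [hP, mem_filter] at this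
      exact this.2
    set d : ℕ := ∏ q ∈ T, q with hd
    have hdpos : 0 < d := prod_pos fun q hq => (hTprime q hq).pos
    have hcT : 0 ≤ ∏ q ∈ T, (c / (q : ℝ)) := prod_nonneg fun q _ => by positivity
    have hsub : (Ioc Y Z).filter (fun n => T ⊆ n.primeFactors) ⊆ (Ioc Y Z).filter (fun n => d ∣ n) := by
      intro n hn
      rw [mem_filter] at hn ⊢
      refine ⟨hn.1, ?_⟩
      rw [hd]
      exact Finset.prod_primes_dvd n (fun q hq => (hTprime q hq).prime)
        fun q hq => (Nat.mem_primeFactors.mp (hn.2 hq)).2.1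
    have hdR : (d : ℝ) = ∏ q ∈ T, (q : ℝ) := by rw [hd]; push_cast; rfl
    calc ∑ n ∈ (Ioc Y Z).filter (fun n => T ⊆ n.primeFactors), (∏ q ∈ T, (c / (q : ℝ))) / (n : ℝ)
        = (∏ q ∈ T, (c / (q : ℝ))) *
            ∑ n ∈ (Ioc Y Z).filter (fun n => T ⊆ n.primeFactors), (n : ℝ)⁻¹ := by
          rw [mul_sum]
          refine sum_congr rfl fun n _ => ?_
          rw [div_eq_mul_inv]
      _ ≤ (∏ q ∈ T, (c / (q : ℝ))) * ∑ n ∈ (Ioc Y Z).filter (fun n => d ∣ n), (n : ℝ)⁻¹ :=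
          mul_le_mul_of_nonneg_left
            (sum_le_sum_of_subset_of_nonneg hsub fun n _ _ => by positivity) hcT
      _ ≤ (∏ q ∈ T, (c / (q : ℝ))) * ((1 + Real.log ((Z : ℝ) / Y)) / d) := by
          gcongr
          exact sum_inv_filter_dvd_Ioc_le hdpos hY hYZ
      _ = (∏ q ∈ T, (c / (q : ℝ))) / (∏ q ∈ T, (q : ℝ)) * (1 + Real.log ((Z : ℝ) / Y)) := by
          rw [hdR]; ring
      _ = (∏ q ∈ T, (c / (q : ℝ) ^ 2)) * (1 + Real.log ((Z : ℝ) / Y)) := by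
          rw [← prod_div_distrib]
          congr 1
          refine prod_congr rfl fun q _ => ?_
          rw [div_div, sq]
  calc ∑ T ∈ P.powerset, ∑ n ∈ (Ioc Y Z).filter (fun n => T ⊆ n.primeFactors),
          (∏ q ∈ T, (c / (q : ℝ))) / (n : ℝ)
      ≤ ∑ T ∈ P.powerset, (∏ q ∈ T, (c / (q : ℝ) ^ 2)) * (1 + Real.log ((Z : ℝ) / Y)) :=
        sum_le_sum hinner
    _ = (∏ q ∈ P, (1 + c / (q : ℝ) ^ 2)) * (1 + Real.log ((Z : ℝ) / Y)) := by
        rw [← sum_mul, prod_one_add]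
    _ ≤ Real.exp (∑ q ∈ P, c / (q : ℝ) ^ 2) * (1 + Real.log ((Z : ℝ) / Y)) := by
        gcongr
        exact Real.prod_one_add_le_exp_sum P fun q => by positivity
    _ ≤ Real.exp c * (1 + Real.log ((Z : ℝ) / Y)) := by
        gcongr
        calc ∑ q ∈ P, c / (q : ℝ) ^ 2 = c * ∑ q ∈ P, ((q : ℝ) ^ 2)⁻¹ := by
              rw [mul_sum]
              refine sum_congr rfl fun q _ => ?_
              rw [div_eq_mul_inv]
          _ ≤ c * 1 := by gcongr; exact sum_primes_inv_sq_le_one' Z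
          _ = c := mul_one c

end Window

end Literature.NumberTheory.LFunctions.Zhang2022.Sec18SjNorm
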